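import Summits.AtomisticToContinuum.HydrodynamicLimit.Theorems.PreShockDoorPieces

/-!
# PreShockDoor, part B — `[E] CoolSlowScaling` is a theorem (`coolSlowScaling_holds`)

Part B of the door-typing node for `OneSphereInfluence.PreShockHomotopy` (stmt-AtomisticToContinuum-13621; lens-1 g40, landed by hand-2 g15).
The exact cool-and-slow symmetry `(ρ, λu, λ²θ)(λt)` of classical hard-sphere Euler solutions, junk-free (unconditional linearity of the
junk-valued derivatives, time rescaling).  LANDING NOTE: the node«s `divergence_const_smul_always` / `torusGradient_const_mul_always` coincide
with the tree«s `…DenseExcursionAthermalScaling.divergence_const_smul` / `gradient_const_mul` (gate dedup), whose module has no hub olean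
(`stale:unbuilt`, critic row 548 (C)); they are therefore re-derived as LOCAL `have`s inside `coolSlowScaling_holds`.  0 sorry.
-/

noncomputable section

open Set Filter MeasureTheory
open scoped Topology ContDiff ENNReal
open Literature.MathematicalPhysics.KineticTheory Literature.Analysis.FunctionSpaces

namespace Summit.AtomisticToContinuum.HydrodynamicLimit.Theorems.PreShockDoor

/-! ## [E] is a theorem (proved here)

### Unconditional linearity of the junk-valued derivatives -/

/-- `deriv (k • g) = k • deriv g` with NO differentiability hypothesis (both sides are junk `0`
together when `k ≠ 0`). [folklore] -/
theorem deriv_const_smul_always {F : Type*} [NormedAddCommGroup F] [NormedSpace ℝ F]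
    (g : ℝ → F) (k t : ℝ) : deriv (fun s => k • g s) t = k • deriv g t := by
  by_cases hk : k = 0
  · subst hk; simp
  by_cases hd : DifferentiableAt ℝ g t
  · exact deriv_const_smul k hd
  · have hd' : ¬ DifferentiableAt ℝ (fun s => k • g s) t := by
      intro h'
      apply hd
      have h2 : DifferentiableAt ℝ (fun s => k⁻¹ • (k • g s)) t := h'.const_smul k⁻¹
      simp only [smul_smul, inv_mul_cancel₀ hk, one_smul] at h2
      exact h2
    rw [deriv_zero_of_not_differentiableAt hd, deriv_zero_of_not_differentiableAt hd', smul_zero]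

/-- `∇(k f) = k ∇f` (Mathlib gradient) with NO differentiability hypothesis. [folklore] -/
theorem gradient_const_mul_always {E : Type*} [NormedAddCommGroup E] [InnerProductSpace ℝ E]
    [CompleteSpace E] (f : E → ℝ) (k : ℝ) (v : E) :
    gradient (fun w => k * f w) v = k • gradient f v := by
  unfold gradient
  by_cases hk : k = 0
  · subst hk; simp
  by_cases hd : DifferentiableAt ℝ f v
  · rw [fderiv_const_mul hd]; simp
  · have hd' : ¬ DifferentiableAt ℝ (fun w => k * f w) v := by
      intro h'
      apply hd
      have h2 : DifferentiableAt ℝ (fun w => k⁻¹ * (k * f w)) v := h'.const_mul k⁻¹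
      simp only [← mul_assoc, inv_mul_cancel₀ hk, one_mul] at h2
      exact h2
    rw [fderiv_zero_of_not_differentiableAt hd, fderiv_zero_of_not_differentiableAt hd', map_zero,
      smul_zero]

/-- `∂ᵢ(k • G) = k • ∂ᵢ G` on the torus, unconditionally. [folklore] -/
theorem partialDeriv_const_smul_always {F : Type*} [NormedAddCommGroup F] [NormedSpace ℝ F]
    (i : Fin 3) (k : ℝ) (G : T3 → F) (x : T3) :
    Torus.partialDeriv i (fun y => k • G y) x = k • Torus.partialDeriv i G x := by
  unfold Torus.partialDeriv Torus.lineDeriv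
  exact deriv_const_smul_always _ k 0

/-! ### Time rescaling `s ↦ c s` -/

/-- Time rescaling keeps `[0, T/c)` inside `[0, T)`. [folklore] -/
theorem mul_mem_Ico_of_mem {T c τ : ℝ} (hc : 0 < c) (hτ : τ ∈ Ico 0 (T / c)) : c * τ ∈ Ico 0 T := by
  refine ⟨mul_nonneg hc.le hτ.1, ?_⟩
  have h2 := hτ.2
  rw [lt_div_iff₀ hc] at h2
  rw [mul_comm]; exact h2

/-- Joint smoothness is preserved by the time rescaling `s ↦ c s`, `c > 0`. [folklore] -/
theorem isSmoothSpaceTimeOn_comp_mul {F : Type*} [NormedAddCommGroup F] [NormedSpace ℝ F]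
    {T c : ℝ} (hc : 0 < c) {φ : ℝ → T3 → F} (hφ : Torus.IsSmoothSpaceTimeOn (Ico 0 T) φ) :
    Torus.IsSmoothSpaceTimeOn (Ico 0 (T / c)) (fun s y => φ (c * s) y) := by
  unfold Torus.IsSmoothSpaceTimeOn at *
  have e : Torus.stLift (fun s y => φ (c * s) y) =
      Torus.stLift φ ∘ fun p : ℝ × EuclideanSpace ℝ (Fin 3) => (c * p.1, p.2) := by
    funext p; rfl
  rw [e]
  refine hφ.comp ((contDiff_const.mul contDiff_fst).prodMk contDiff_snd).contDiffOn ?_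
  intro p hp
  exact mk_mem_prod (mul_mem_Ico_of_mem hc (mem_prod.1 hp).1) (mem_univ _)

/-- Constant multiples keep joint smoothness. [folklore] -/
theorem isSmoothSpaceTimeOn_const_smul' {F : Type*} [NormedAddCommGroup F] [NormedSpace ℝ F]
    {S : Set ℝ} {φ : ℝ → T3 → F} (hφ : Torus.IsSmoothSpaceTimeOn S φ) (k : ℝ) :
    Torus.IsSmoothSpaceTimeOn S (fun s y => k • φ s y) := by
  unfold Torus.IsSmoothSpaceTimeOn at *
  exact hφ.const_smul k

/-- Chain rule for the one-sided time derivative under `s ↦ c s`. [folklore] -/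
theorem timeDerivWithin_comp_mul {F : Type*} [NormedAddCommGroup F] [NormedSpace ℝ F]
    {T c : ℝ} (hc : 0 < c) {φ : ℝ → T3 → F} (hφ : Torus.IsSmoothSpaceTimeOn (Ico 0 T) φ)
    {t : ℝ} (ht : t ∈ Ico 0 (T / c)) (x : T3) :
    Torus.timeDerivWithin (Ico 0 (T / c)) (fun s y => φ (c * s) y) t x =
      c • Torus.timeDerivWithin (Ico 0 T) φ (c * t) x := by
  have h1 := hφ.hasDerivWithinAt_slice (mul_mem_Ico_of_mem hc ht) x
  have h2 : HasDerivWithinAt (fun τ : ℝ => c * τ) c (Ico 0 (T / c)) t := by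
    simpa using ((hasDerivAt_id t).const_mul c).hasDerivWithinAt
  have hmaps : MapsTo (fun τ : ℝ => c * τ) (Ico 0 (T / c)) (Ico 0 T) :=
    fun τ hτ => mul_mem_Ico_of_mem hc hτ
  have h3 := h1.scomp t h2 hmaps
  exact h3.derivWithin (uniqueDiffOn_Ico 0 (T / c) t ht)

/-- `∂ₜ(k • φ) = k • ∂ₜφ` (one-sided, within `S`) for jointly smooth `φ`. [folklore] -/
theorem timeDerivWithin_const_smul' {F : Type*} [NormedAddCommGroup F] [NormedSpace ℝ F]
    {S : Set ℝ} {φ : ℝ → T3 → F} (hφ : Torus.IsSmoothSpaceTimeOn S φ) (hS : UniqueDiffOn ℝ S)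
    {t : ℝ} (ht : t ∈ S) (x : T3) (k : ℝ) :
    Torus.timeDerivWithin S (fun s y => k • φ s y) t x = k • Torus.timeDerivWithin S φ t x :=
  ((hφ.hasDerivWithinAt_slice ht x).const_smul k).derivWithin (hS t ht)

/-! ### The proof of [E] -/

/-- **[E] is a theorem**: the cool-and-slow scaling of a classical hard-sphere Euler solution is a
classical solution (every identity junk-free). PROVED here, so [E] leaves the door. -/
theorem coolSlowScaling_holds : CoolSlowScaling := by
  intro σ T c ρ θ u hc h
  -- `div(k • F) = k div F` and `∇(k p) = k • ∇p` on the torus, unconditionally (= tree `…DenseExcursionAthermalScaling.*`, unbuilt on the hub)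
  have divergence_const_smul_always : ∀ (k : ℝ) (F : T3 → V3) (x : T3),
      Torus.divergence (fun y => k • F y) x = k * Torus.divergence F x := by
    intro k F x
    unfold Torus.divergence
    rw [Finset.mul_sum]
    refine Finset.sum_congr rfl fun i _ => ?_
    have e : (fun y => (k • F y) i) = fun y => k • F y i := by
      funext y; rw [PiLp.smul_apply]
    rw [e, partialDeriv_const_smul_always, smul_eq_mul]
  have torusGradient_const_mul_always : ∀ (k : ℝ) (p : T3 → ℝ) (x : T3),
      Torus.gradient (fun y => k * p y) x = k • Torus.gradient p x := by
    intro k p x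
    unfold Torus.gradient
    show gradient (fun v => k * p (x + Torus.proj v)) 0 = k • gradient (fun v => p (x + Torus.proj v)) 0
    exact gradient_const_mul_always _ k 0
  have hmem : ∀ {t : ℝ}, t ∈ Ico 0 (T / c) → c * t ∈ Ico 0 T := fun ht => mul_mem_Ico_of_mem hc ht
  have hU : UniqueDiffOn ℝ (Ico 0 (T / c)) := uniqueDiffOn_Ico 0 (T / c)
  -- smoothness of the products entering the time derivatives
  have hMom : Torus.IsSmoothSpaceTimeOn (Ico 0 T) (fun s y => ρ s y • u s y) := by
    have h1 := h.smooth_density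
    have h2 := h.smooth_velocity
    unfold Torus.IsSmoothSpaceTimeOn at h1 h2 ⊢
    exact h1.smul h2
  have hEn : Torus.IsSmoothSpaceTimeOn (Ico 0 T)
      (fun s y => totalEnergyDensity (ρ s y) (u s y) (θ s y)) := by
    have h1 := h.smooth_density
    have h2 := h.smooth_velocity
    have h3 := h.smooth_temperature
    unfold Torus.IsSmoothSpaceTimeOn at h1 h2 h3 ⊢
    have e : Torus.stLift (fun s y => totalEnergyDensity (ρ s y) (u s y) (θ s y)) =
        fun p => Torus.stLift ρ p * (‖Torus.stLift u p‖ ^ 2 / 2 + 3 / 2 * Torus.stLift θ p) := by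
      funext p; rfl
    rw [e]
    exact h1.mul (((h2.norm_sq ℝ).div_const _).add (contDiffOn_const.mul h3))
  refine ⟨?_, ?_, ?_, ?_, ?_, ?_, ?_, ?_⟩
  · exact isSmoothSpaceTimeOn_comp_mul hc h.smooth_density
  · exact isSmoothSpaceTimeOn_const_smul' (isSmoothSpaceTimeOn_comp_mul hc h.smooth_velocity) c
  · exact isSmoothSpaceTimeOn_const_smul' (isSmoothSpaceTimeOn_comp_mul hc h.smooth_temperature)
      (c ^ 2)
  · intro t ht x
    exact h.density_pos _ (hmem ht) x
  · intro t ht x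
    exact mul_pos (pow_pos hc 2) (h.temperature_pos _ (hmem ht) x)
  · -- mass
    intro t ht x
    have hm := h.mass (c * t) (hmem ht) x
    beta_reduce
    have e1 : (fun y => ρ (c * t) y • c • u (c * t) y) = fun y => c • (ρ (c * t) y • u (c * t) y) := by
      funext y; rw [smul_comm]
    rw [timeDerivWithin_comp_mul hc h.smooth_density ht x, e1, divergence_const_smul_always,
      smul_eq_mul, ← mul_add, hm, mul_zero]
  · -- momentum
    intro t ht x
    have hm := h.momentum (c * t) (hmem ht) x
    have hA : Torus.timeDerivWithin (Ico 0 (T / c)) (fun s y => ρ (c * s) y • c • u (c * s) y) t x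
        = c ^ 2 • Torus.timeDerivWithin (Ico 0 T) (fun s y => ρ s y • u s y) (c * t) x := by
      have e1 : (fun s y => ρ (c * s) y • c • u (c * s) y) =
          fun s y => c • (ρ (c * s) y • u (c * s) y) := by
        funext s y; rw [smul_comm]
      rw [e1, timeDerivWithin_const_smul' (isSmoothSpaceTimeOn_comp_mul hc hMom) hU ht,
        timeDerivWithin_comp_mul hc hMom ht x, smul_smul, ← pow_two]
    have hB : ∀ i, Torus.partialDeriv i
        (fun y => (ρ (c * t) y * (c • u (c * t) y) i) • c • u (c * t) y) x
        = c ^ 2 • Torus.partialDeriv i (fun y => (ρ (c * t) y * u (c * t) y i) • u (c * t) y) x := by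
      intro i
      have e2 : (fun y => (ρ (c * t) y * (c • u (c * t) y) i) • c • u (c * t) y)
          = fun y => (c ^ 2) • ((ρ (c * t) y * u (c * t) y i) • u (c * t) y) := by
        funext y
        rw [PiLp.smul_apply, smul_eq_mul, smul_smul, smul_smul]
        congr 1
        ring
      rw [e2, partialDeriv_const_smul_always]
    have hC : Torus.gradient (fun y => hsPressure σ (ρ (c * t) y) (c ^ 2 * θ (c * t) y)) x
        = c ^ 2 • Torus.gradient (fun y => hsPressure σ (ρ (c * t) y) (θ (c * t) y)) x := by
      have e3 : (fun y => hsPressure σ (ρ (c * t) y) (c ^ 2 * θ (c * t) y))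
          = fun y => c ^ 2 * hsPressure σ (ρ (c * t) y) (θ (c * t) y) := by
        funext y; simp only [hsPressure]; ring
      rw [e3, torusGradient_const_mul_always]
    beta_reduce
    rw [hA, hC, Finset.sum_congr rfl (fun i _ => hB i), ← Finset.smul_sum, ← smul_add, ← smul_add,
      hm, smul_zero]
  · -- energy
    intro t ht x
    have hm := h.energy (c * t) (hmem ht) x
    have hA : Torus.timeDerivWithin (Ico 0 (T / c))
        (fun s y => totalEnergyDensity (ρ (c * s) y) (c • u (c * s) y) (c ^ 2 * θ (c * s) y)) t x
        = c ^ 3 * Torus.timeDerivWithin (Ico 0 T)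
            (fun s y => totalEnergyDensity (ρ s y) (u s y) (θ s y)) (c * t) x := by
      have e4 : (fun s y => totalEnergyDensity (ρ (c * s) y) (c • u (c * s) y) (c ^ 2 * θ (c * s) y))
          = fun s y => c ^ 2 • totalEnergyDensity (ρ (c * s) y) (u (c * s) y) (θ (c * s) y) := by
        funext s y
        simp only [totalEnergyDensity, smul_eq_mul]
        rw [norm_smul, Real.norm_eq_abs, abs_of_pos hc]
        ring
      rw [e4, timeDerivWithin_const_smul' (isSmoothSpaceTimeOn_comp_mul hc hEn) hU ht,
        timeDerivWithin_comp_mul hc hEn ht x, smul_eq_mul, smul_eq_mul]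
      ring
    have hB : Torus.divergence (fun y =>
        (totalEnergyDensity (ρ (c * t) y) (c • u (c * t) y) (c ^ 2 * θ (c * t) y) +
          hsPressure σ (ρ (c * t) y) (c ^ 2 * θ (c * t) y)) • c • u (c * t) y) x
        = c ^ 3 * Torus.divergence (fun y =>
        (totalEnergyDensity (ρ (c * t) y) (u (c * t) y) (θ (c * t) y) +
          hsPressure σ (ρ (c * t) y) (θ (c * t) y)) • u (c * t) y) x := by
      have e5 : (fun y =>
          (totalEnergyDensity (ρ (c * t) y) (c • u (c * t) y) (c ^ 2 * θ (c * t) y) +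
            hsPressure σ (ρ (c * t) y) (c ^ 2 * θ (c * t) y)) • c • u (c * t) y)
          = fun y => c ^ 3 • ((totalEnergyDensity (ρ (c * t) y) (u (c * t) y) (θ (c * t) y) +
            hsPressure σ (ρ (c * t) y) (θ (c * t) y)) • u (c * t) y) := by
        funext y
        simp only [totalEnergyDensity, hsPressure]
        rw [norm_smul, Real.norm_eq_abs, abs_of_pos hc, smul_smul, smul_smul]
        congr 1
        ring
      rw [e5, divergence_const_smul_always]
    beta_reduce
    rw [hA, hB, ← mul_add, hm, mul_zero]


end Summit.AtomisticToContinuum.HydrodynamicLimit.Theorems.PreShockDoor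

end
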